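import Literature.NumberTheory.Sieve.SmoothZetaDecayBlocks
import HarnessLib

/-!
# The decay sum of `ζ(s, y)` on a block `(z/e³, z]` for `3 ≤ |t| ≤ z/(K log z)`: Brun–Titchmarsh in short intervals

Topic `Literature/NumberTheory/Sieve`; a PROVED tool file, sequel of `SmoothZetaDecayBlocks` (same method, same
notation). The tree's `exists_blockDecaySum_ge` bounds the block contribution to Hildebrand–Tenenbaum's
`W(t) = Σ_{p ≤ y} p^{-σ}(1 - cos(t log p))` from below by `c z^{1-σ}/log z` for `3 ≤ |t| ≤ κ z^{9/10}`, the bad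
primes (those with `t log p` within `ε'` of `2πℤ`, `ε'` an absolute constant) lying in intervals of length `≥ z^{1/10}`.
Here the SAME argument is run with `ε' = 1/(K₁ log z)`: the bad primes then lie in `≤ 3|t|/2` intervals of length
`≍ z/(K₁ |t| log z)`, which is `≥ 2` as long as `|t| ≤ z/(K log z)`; on such (possibly very short) intervals the
tree's Brun–Titchmarsh inequality `sum_log_primes_Ioc_le` (`Σ_{N < p ≤ N+M} log p ≤ C M log(N+M)/log M`) saves
only the factor `log M ≥ log 2`, which the small `ε'` compensates. Result:

* `exists_blockDecaySum_ge_short` — there are absolute `c, K > 0` and `z₀` with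
  `Σ_{z/e³ < p ≤ z} p^{-σ}(1 - cos(t log p)) ≥ c z^{1-σ}/(log z)³` for all real `z ≥ z₀`, all `σ ≥ 0` and all
  `3 ≤ |t| ≤ z/(K log z)`.

This closes the gap between the Brun–Titchmarsh regime `|t| ≤ κ z^{9/10}` and the height `≍ z/log z` (where the
tree's pigeonhole bound `exists_blockDecaySum_ge_of_le_div_log`, of size `(t/z)² z^{1-σ}/log z`, is too small to be
useful for `|t| ≤ z^{1-δ}`); no information on the zeros of `ζ` is used.
[cite: HildebrandTenenbaum1986, §3 Lemma 8 (ii), proof of (3.16)]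

## References

* [HildebrandTenenbaum1986] A. Hildebrand, G. Tenenbaum, Trans. AMS 296 (1986) 265–290, §3 Lemma 8 (ii)–(iii)
  (held: `paper:doi-10-1090-s0002-9947-1986-0837811-1`, pp. 275–276).
* H. Halberstam, H.-E. Richert, *Sieve Methods*, Academic Press 1974, Ch. 3 (Brun–Titchmarsh).
-/

noncomputable section

open Real Finset Chebyshev

namespace Literature.NumberTheory.Sieve

/-- Sums of a non-negative function over a `Finset.biUnion` are at most the iterated sums. [folklore] -/
private theorem sum_biUnion_le_sum₃ {ι κ : Type*} [DecidableEq κ] (s : Finset ι) (t : ι → Finset κ)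
    {f : κ → ℝ} (hf : ∀ x, 0 ≤ f x) :
    ∑ x ∈ s.biUnion t, f x ≤ ∑ i ∈ s, ∑ x ∈ t i, f x := by
  classical
  induction s using Finset.induction_on with
  | empty => simp
  | insert a s ha ih =>
    rw [Finset.biUnion_insert, Finset.sum_insert ha]
    have hu := Finset.sum_union_inter (s₁ := t a) (s₂ := s.biUnion t) (f := f)
    have hi : 0 ≤ ∑ x ∈ t a ∩ s.biUnion t, f x := Finset.sum_nonneg fun x _ ↦ hf x
    linarith

variable {z σ t : ℝ}

set_option maxHeartbeats 1600000 in
/-- **Decay on a block, short-interval Brun–Titchmarsh regime.** There are absolute `c, K > 0` and `z₀` such that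
for all real `z ≥ z₀`, all `σ ≥ 0` and all `t` with `3 ≤ |t| ≤ z/(K log z)`:
`Σ_{z/e³ < p ≤ z} p^{-σ}(1 - cos(t log p)) ≥ c · z^{1-σ}/(log z)³`.
Proof as for `exists_blockDecaySum_ge` with `ε' = 1/(K₁ log z)`, `K₁ = 16000(C+1)` (`C` the Brun–Titchmarsh constant of
`sum_log_primes_Ioc_le`), `K = 300 K₁`: the block has `θ`-mass `≥ 0.27 z`; the bad primes lie in `≤ 3|t|/2` intervals
`(e^{kP-r}, e^{kP+r})`, `P = 2π/|t|`, `r = ε'/|t|`, each containing `M ≥ 1.9 r z e^{-5.3} ≥ 2` integers and hence of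
`θ`-mass `≤ C M (log z + 3)/log 2`; in total `≤ 57 C ε' (log z + 3) z + 5 C (log z + 3)|t| ≤ z/10`. The good primes give
`≥ (1 - cos ε') · 0.17 z^{1-σ}/log z ≥ (2/π²) ε'² · 0.17 z^{1-σ}/log z`.
[cite: HildebrandTenenbaum1986, §3 Lemma 8 (ii)–(iii), proof of (3.16)] -/
theorem exists_blockDecaySum_ge_short :
    ∃ c : ℝ, 0 < c ∧ ∃ K : ℝ, 0 < K ∧ ∃ z₀ : ℝ, 0 < z₀ ∧ ∀ z : ℝ, z₀ ≤ z → ∀ σ : ℝ, 0 ≤ σ →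
      ∀ t : ℝ, 3 ≤ |t| → |t| ≤ z / (K * Real.log z) →
        c * (z ^ (1 - σ) / Real.log z ^ 3) ≤
          ∑ p ∈ Nat.primesLE ⌊z⌋₊ \ Nat.primesLE ⌊z * Real.exp (-3)⌋₊,
            (p : ℝ) ^ (-σ) * (1 - Real.cos (t * Real.log p)) := by
  classical
  obtain ⟨C, hC, hBT⟩ := sum_log_primes_Ioc_le
  obtain ⟨z₁, hz₁, hθ⟩ := exists_theta_block_ge
  -- constants
  set K₁ : ℝ := 16000 * (C + 1) with hK₁
  have hK₁0 : 0 < K₁ := by positivity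
  set K : ℝ := 300 * K₁ with hK
  have hK0 : 0 < K := by positivity
  set Z : ℝ := max (Real.exp 60) z₁ with hZ
  refine ⟨17 / 100 * (2 / Real.pi ^ 2) / K₁ ^ 2, by positivity, K, hK0, Z,
    lt_of_lt_of_le (Real.exp_pos 60) (le_max_left _ _), fun z hz σ hσ t ht3 htK => ?_⟩
  have hz60 : Real.exp 60 ≤ z := le_trans (le_max_left _ _) hz
  have hzz₁ : z₁ ≤ z := le_trans (le_max_right _ _) hz
  have hz0 : 0 < z := lt_of_lt_of_le (Real.exp_pos _) hz60
  have hz1 : 1 < z := lt_of_lt_of_le (by have := Real.add_one_le_exp (60 : ℝ); linarith) hz60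
  set L : ℝ := Real.log z with hL
  have hL60 : 60 ≤ L := by
    have := Real.log_le_log (Real.exp_pos _) hz60; rwa [Real.log_exp] at this
  have hL0 : 0 < L := by linarith
  -- `ε' = 1/(K₁ L)`
  set ε' : ℝ := 1 / (K₁ * L) with hε'
  have hε'0 : 0 < ε' := by positivity
  have hε'20 : ε' ≤ 1 / 20 := by
    rw [hε', div_le_div_iff₀ (by positivity) (by norm_num)]
    have : (20 : ℝ) ≤ K₁ * L := by
      have h1 : (16000 : ℝ) ≤ K₁ := by rw [hK₁]; nlinarith
      nlinarith
    linarith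
  have hCε'L : C * ε' * (L + 3) ≤ 1 / 15000 := by
    have h1 : C * ε' * (L + 3) = C * (L + 3) / (K₁ * L) := by rw [hε']; field_simp
    rw [h1, div_le_div_iff₀ (by positivity) (by norm_num), hK₁]
    -- `15000 C (L+3) ≤ 16000 (C+1) L` since `L ≥ 60`
    nlinarith [mul_nonneg hC.le hL0.le]
  -- reduce to `t > 0`
  wlog htpos : 0 < t generalizing t
  · have ht0 : t ≤ 0 := le_of_not_gt htpos
    have htne : t ≠ 0 := by intro h; rw [h, abs_zero] at ht3; linarith
    have h := this (-t) (by rwa [abs_neg]) (by rwa [abs_neg]) (by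
      rcases lt_or_eq_of_le ht0 with h | h
      · linarith
      · exact absurd h htne)
    simpa [neg_mul, Real.cos_neg] using h
  rw [abs_of_pos htpos] at ht3 htK
  have hπ := Real.pi_gt_d2
  have hπ' := Real.pi_lt_d2
  set P : ℝ := 2 * Real.pi / t with hP
  set r : ℝ := ε' / t with hr
  have hP0 : 0 < P := by positivity
  have hP21 : P ≤ 21 / 10 := by rw [hP, div_le_iff₀ htpos]; linarith
  have hr0 : 0 < r := by positivity
  have hr20 : r ≤ 1 / 20 := by
    rw [hr, div_le_iff₀ htpos]
    have : ε' ≤ 1 / 20 * 3 := by linarith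
    nlinarith
  have hrt : r * t = ε' := by rw [hr]; field_simp
  -- `r z ≥ 300`: from `t ≤ z/(K L)`, `r z = ε' z/t = z/(K₁ L t) ≥ K/K₁ = 300`
  have hrz : 300 ≤ r * z := by
    have hKL : 0 < K * L := by positivity
    have h1 : t * (K * L) ≤ z := by rwa [le_div_iff₀ hKL] at htK
    rw [hr, div_mul_eq_mul_div, le_div_iff₀ htpos, hε']
    rw [hK] at h1
    have h2 : 300 * t = 1 / (K₁ * L) * (t * (300 * K₁ * L)) := by field_simp
    rw [h2]
    exact mul_le_mul_of_nonneg_left h1 (by positivity)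
  -- the block and its mass
  set Q : Finset ℕ := Nat.primesLE ⌊z⌋₊ \ Nat.primesLE ⌊z * Real.exp (-3)⌋₊ with hQ
  have hza : z * Real.exp (-3) ≤ z := by
    have : Real.exp (-3) ≤ 1 := Real.exp_le_one_iff.2 (by norm_num)
    exact mul_le_of_le_one_right hz0.le this
  have hQmass : ∑ p ∈ Q, Real.log p = θ z - θ (z * Real.exp (-3)) := by
    rw [hQ, theta_sub_theta_eq_sum_sdiff hza]
  have htotal : 27 / 100 * z ≤ ∑ p ∈ Q, Real.log p := by rw [hQmass]; exact hθ z hzz₁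
  set Bad : Finset ℕ := Q.filter (fun p => ∃ k : ℤ, |t * Real.log p - k * (2 * Real.pi)| < ε') with hBad
  set Good : Finset ℕ := Q.filter (fun p => ¬ ∃ k : ℤ, |t * Real.log p - k * (2 * Real.pi)| < ε') with hGood
  have hsplit : ∑ p ∈ Q, Real.log p = ∑ p ∈ Good, Real.log p + ∑ p ∈ Bad, Real.log p := by
    rw [hGood, hBad, add_comm, Finset.sum_filter_add_sum_filter_not]
  -- ### the bad mass is at most `z/10`
  have hbad : ∑ p ∈ Bad, Real.log p ≤ z / 10 := by
    set Kset : Finset ℤ := Finset.Icc ⌊(L - 3 - r) / P⌋ ⌈(L + r) / P⌉ with hKset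
    set N : ℤ → ℕ := fun k => ⌊Real.exp (k * P - r)⌋₊ with hN
    set M : ℤ → ℕ := fun k => ⌈Real.exp (k * P + r)⌉₊ - ⌊Real.exp (k * P - r)⌋₊ with hM
    set S : ℤ → Finset ℕ := fun k => (Ioc (N k) (N k + M k)).filter Nat.Prime with hS
    -- (1) covering
    have hcover : Bad ⊆ Kset.biUnion S := by
      intro p hp
      rw [hBad, Finset.mem_filter] at hp
      have h := mem_biUnion_of_bad (z := z) hz0 htpos hr0 hp.1 (by rw [hrt]; exact hp.2)
      simpa only [hKset, hS, hN, hM, hP, hL] using h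
    -- (2) Brun–Titchmarsh on each `S k`
    have hper : ∀ k ∈ Kset, ∑ p ∈ S k, Real.log p ≤ 3 / 2 * C * (L + 3) * (26 * ε' * z / t + 2) := by
      intro k hk
      rw [hKset, Finset.mem_Icc] at hk
      set E : ℝ := Real.exp (k * P) with hE
      have hE0 : 0 < E := Real.exp_pos _
      have hkP_lo : L - 3 - r - P ≤ k * P := by
        have h1 : ((⌊(L - 3 - r) / P⌋ : ℤ) : ℝ) ≤ k := by exact_mod_cast hk.1
        have h2 : (L - 3 - r) / P - 1 < ⌊(L - 3 - r) / P⌋ := by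
          have := Int.lt_floor_add_one ((L - 3 - r) / P); linarith
        have h3 : (L - 3 - r) / P - 1 ≤ k := by linarith
        have := mul_le_mul_of_nonneg_right h3 hP0.le
        rwa [sub_mul, div_mul_cancel₀ _ hP0.ne', one_mul] at this
      have hkP_hi : k * P ≤ L + r + P := by
        have h1 : (k : ℝ) ≤ ((⌈(L + r) / P⌉ : ℤ) : ℝ) := by exact_mod_cast hk.2
        have h2 : ((⌈(L + r) / P⌉ : ℤ) : ℝ) < (L + r) / P + 1 := Int.ceil_lt_add_one _
        have h3 : (k : ℝ) ≤ (L + r) / P + 1 := by linarith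
        have := mul_le_mul_of_nonneg_right h3 hP0.le
        rwa [add_mul, div_mul_cancel₀ _ hP0.ne', one_mul] at this
      have hE_hi : E ≤ Real.exp (23 / 10) * z := by
        calc E ≤ Real.exp (L + (23 / 10)) := Real.exp_le_exp.2 (by linarith)
          _ = Real.exp (23 / 10) * z := by rw [Real.exp_add, hL, Real.exp_log hz0]; ring
      have hE_lo : z * Real.exp (-(53 / 10)) ≤ E := by
        calc z * Real.exp (-(53 / 10)) = Real.exp (L + -(53 / 10)) := by
              rw [Real.exp_add, hL, Real.exp_log hz0]
          _ ≤ E := Real.exp_le_exp.2 (by linarith)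
      obtain ⟨hexp_lo, hexp_hi⟩ := exp_sub_exp_neg_bounds hr0.le hr20
      have hfloor_le : ⌊Real.exp (k * P - r)⌋₊ ≤ ⌈Real.exp (k * P + r)⌉₊ := by
        have h5 : (⌊Real.exp (k * P - r)⌋₊ : ℝ) ≤ Real.exp (k * P - r) := Nat.floor_le (Real.exp_pos _).le
        have h6 : Real.exp (k * P - r) ≤ Real.exp (k * P + r) := Real.exp_le_exp.2 (by linarith)
        exact_mod_cast (h5.trans (h6.trans (Nat.le_ceil _)))
      have h3E : Real.exp (k * P + r) = E * Real.exp r := by rw [hE, ← Real.exp_add]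
      have h4E : Real.exp (k * P - r) = E * Real.exp (-r) := by rw [hE, ← Real.exp_add]; ring_nf
      have hMreal_hi : (M k : ℝ) ≤ 21 / 10 * r * E + 2 := by
        simp only [hM]
        have h1 : (⌈Real.exp (k * P + r)⌉₊ : ℝ) < Real.exp (k * P + r) + 1 := Nat.ceil_lt_add_one (Real.exp_pos _).le
        have h2 : Real.exp (k * P - r) - 1 < ⌊Real.exp (k * P - r)⌋₊ := by
          have := Nat.lt_floor_add_one (Real.exp (k * P - r)); linarith
        rw [Nat.cast_sub hfloor_le]
        have h7 : E * Real.exp r - E * Real.exp (-r) = E * (Real.exp r - Real.exp (-r)) := by ring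
        have h8 := mul_le_mul_of_nonneg_left hexp_hi hE0.le
        nlinarith [h7, h8, h1, h2, h3E, h4E]
      have hMreal_lo : 19 / 10 * r * E ≤ (M k : ℝ) := by
        simp only [hM]
        have h1 : Real.exp (k * P + r) ≤ (⌈Real.exp (k * P + r)⌉₊ : ℝ) := Nat.le_ceil _
        have h2 : (⌊Real.exp (k * P - r)⌋₊ : ℝ) ≤ Real.exp (k * P - r) := Nat.floor_le (Real.exp_pos _).le
        rw [Nat.cast_sub hfloor_le]
        have h7 : E * Real.exp r - E * Real.exp (-r) = E * (Real.exp r - Real.exp (-r)) := by ring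
        have h8 := mul_le_mul_of_nonneg_left hexp_lo hE0.le
        nlinarith [h7, h8, h1, h2, h3E, h4E]
      -- `r E ≥ 300 e^{-5.3} ≥ 6/5`, so `M k ≥ 2`
      have he53 := one_div_le_exp_neg
      have hrE : 6 / 5 ≤ r * E := by
        have h1 : r * (z * Real.exp (-(53 / 10))) ≤ r * E := mul_le_mul_of_nonneg_left hE_lo hr0.le
        have h2 : 300 * (1 / 250) ≤ r * z * Real.exp (-(53 / 10)) :=
          mul_le_mul hrz he53 (by norm_num) (by positivity)
        nlinarith
      have hM2 : 2 ≤ M k := by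
        have : (2 : ℝ) ≤ M k := by nlinarith
        exact_mod_cast this
      have hM0 : (0 : ℝ) < M k := by exact_mod_cast (lt_of_lt_of_le zero_lt_two hM2)
      have hlogM : Real.log 2 ≤ Real.log (M k) := Real.log_le_log (by norm_num) (by exact_mod_cast hM2)
      have hlog2 : (2 : ℝ) / 3 < Real.log 2 := by have := Real.log_two_gt_d9; linarith
      have hlogM0 : 0 < Real.log (M k) := by linarith
      have hlogNM : Real.log (((N k + M k : ℕ)) : ℝ) ≤ L + 3 := by
        have hNM' : N k + M k = ⌈Real.exp (k * P + r)⌉₊ := by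
          simp only [hN, hM]; omega
        have hNM : ((N k + M k : ℕ) : ℝ) ≤ Real.exp (k * P + r) + 1 := by
          rw [hNM']; exact (Nat.ceil_lt_add_one (Real.exp_pos _).le).le
        have hpos : (0 : ℝ) < ((N k + M k : ℕ) : ℝ) := by
          have hN0 : (0 : ℝ) ≤ (N k : ℝ) := Nat.cast_nonneg _
          push_cast; linarith
        calc Real.log (((N k + M k : ℕ)) : ℝ) ≤ Real.log (Real.exp (k * P + r) + 1) := Real.log_le_log hpos hNM
          _ ≤ Real.log (Real.exp (L + 3)) := by
              refine Real.log_le_log (by positivity) ?_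
              have h1 : Real.exp (k * P + r) ≤ Real.exp (L + 2.3) := Real.exp_le_exp.2 (by linarith)
              have h3 : Real.exp (L + 3) = Real.exp (L + 2.3) * Real.exp 0.7 := by rw [← Real.exp_add]; ring_nf
              have h4 : (1 : ℝ) + 0.7 ≤ Real.exp 0.7 := by have := Real.add_one_le_exp (0.7 : ℝ); linarith
              have h5 : (33 : ℝ) ≤ Real.exp (L + 2.3) := by have := Real.add_one_le_exp (L + 2.3); linarith
              have h6 := mul_le_mul_of_nonneg_left h4 (Real.exp_pos (L + 2.3)).le
              rw [h3]; linarith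
          _ = L + 3 := Real.log_exp _
      have hbt := hBT (N k) (M k) hM2
      calc ∑ p ∈ S k, Real.log p ≤ C * (M k) * Real.log (((N k + M k : ℕ)) : ℝ) / Real.log (M k) := hbt
        _ ≤ C * (M k) * (L + 3) / Real.log 2 := by
            have hnum : C * (M k) * Real.log (((N k + M k : ℕ)) : ℝ) ≤ C * (M k) * (L + 3) :=
              mul_le_mul_of_nonneg_left hlogNM (by positivity)
            calc C * (M k) * Real.log (((N k + M k : ℕ)) : ℝ) / Real.log (M k)
                ≤ C * (M k) * (L + 3) / Real.log (M k) := div_le_div_of_nonneg_right hnum hlogM0.le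
              _ ≤ C * (M k) * (L + 3) / Real.log 2 := div_le_div_of_nonneg_left (by positivity) (by linarith) hlogM
        _ ≤ C * (M k) * (L + 3) * (3 / 2) := by
            rw [div_le_iff₀ (by linarith)]
            have : C * (M k) * (L + 3) * 1 ≤ C * (M k) * (L + 3) * (3 / 2 * Real.log 2) :=
              mul_le_mul_of_nonneg_left (by linarith) (by positivity)
            linarith
        _ ≤ C * (21 / 10 * r * E + 2) * (L + 3) * (3 / 2) := by
            have := mul_le_mul_of_nonneg_left hMreal_hi hC.le
            have hL3 : (0 : ℝ) ≤ (L + 3) * (3 / 2) := by positivity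
            nlinarith
        _ ≤ 3 / 2 * C * (L + 3) * (26 * ε' * z / t + 2) := by
            have hrE_hi : r * E ≤ ε' / t * (12 * z) := by
              rw [hr]
              exact mul_le_mul_of_nonneg_left (le_trans hE_hi (mul_le_mul_of_nonneg_right exp_le_twelve hz0.le))
                (by positivity)
            have h2 : 21 / 10 * r * E ≤ 26 * ε' * z / t := by
              have : 21 / 10 * (r * E) ≤ 21 / 10 * (ε' / t * (12 * z)) := mul_le_mul_of_nonneg_left hrE_hi (by norm_num)
              have h3 : 21 / 10 * (ε' / t * (12 * z)) ≤ 26 * ε' * z / t := by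
                rw [show 21 / 10 * (ε' / t * (12 * z)) = (252 / 10) * ε' * z / t by ring]
                exact div_le_div_of_nonneg_right (by nlinarith [hε'0, hz0]) htpos.le
              nlinarith
            have hL3 : (0 : ℝ) ≤ 3 / 2 * C * (L + 3) := by positivity
            nlinarith [mul_le_mul_of_nonneg_left h2 hL3]
    -- (3) the number of `k`
    have hcardK : (Kset.card : ℝ) ≤ 3 / 2 * t := card_Icc_indices_le ht3 hr0.le hr20
    -- (4) assemble
    calc ∑ p ∈ Bad, Real.log p ≤ ∑ p ∈ Kset.biUnion S, Real.log p :=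
          Finset.sum_le_sum_of_subset_of_nonneg hcover fun p hp _ => by
            obtain ⟨k, -, hk⟩ := Finset.mem_biUnion.1 hp
            exact Real.log_nonneg (by exact_mod_cast (Finset.mem_filter.1 hk).2.one_lt.le)
      _ ≤ ∑ k ∈ Kset, ∑ p ∈ S k, Real.log p := by
          refine sum_biUnion_le_sum₃ Kset S fun p => ?_
          rcases Nat.eq_zero_or_pos p with rfl | hp
          · simp
          · exact Real.log_nonneg (by exact_mod_cast hp)
      _ ≤ ∑ k ∈ Kset, (3 / 2 * C * (L + 3) * (26 * ε' * z / t + 2)) := Finset.sum_le_sum hper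
      _ = Kset.card * (3 / 2 * C * (L + 3) * (26 * ε' * z / t + 2)) := by rw [Finset.sum_const, nsmul_eq_mul]
      _ ≤ 3 / 2 * t * (3 / 2 * C * (L + 3) * (26 * ε' * z / t + 2)) :=
          mul_le_mul_of_nonneg_right hcardK (by positivity)
      _ = 117 / 2 * (C * ε' * (L + 3)) * z + 9 / 2 * (C * (L + 3) * t) := by field_simp; ring
      _ ≤ z / 10 := by
          have h1 : 117 / 2 * (C * ε' * (L + 3)) * z ≤ 117 / 2 * (1 / 15000) * z :=
            mul_le_mul_of_nonneg_right (mul_le_mul_of_nonneg_left hCε'L (by norm_num)) hz0.le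
          -- `C (L+3) t ≤ C (L+3) z/(K L) ≤ z/95`
          have h2 : C * (L + 3) * t ≤ z / 95 := by
            have hKL : 0 < K * L := by positivity
            have ht' : t ≤ z / (K * L) := htK
            have h3 : C * (L + 3) * t ≤ C * (L + 3) * (z / (K * L)) := mul_le_mul_of_nonneg_left ht' (by positivity)
            have h4 : C * (L + 3) * (z / (K * L)) ≤ z / 95 := by
              rw [mul_div_assoc', div_le_div_iff₀ hKL (by norm_num), hK, hK₁]
              -- `95 C (L+3) z ≤ 300·16000 (C+1) L z`
              have h5 : 95 * (C * (L + 3)) ≤ 300 * (16000 * (C + 1)) * L := by nlinarith [mul_nonneg hC.le hL0.le]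
              nlinarith [mul_le_mul_of_nonneg_right h5 hz0.le]
            linarith
          linarith
  -- ### the good primes
  have hgood_mass : 17 / 100 * z ≤ ∑ p ∈ Good, Real.log p := by linarith
  have hGsub : Good ⊆ Q := Finset.filter_subset _ _
  have hfar : ∀ p ∈ Good, ∀ k : ℤ, ε' ≤ |t * Real.log p - k * (2 * Real.pi)| := by
    intro p hp k
    rw [hGood, Finset.mem_filter] at hp
    have h := hp.2
    push Not at h
    exact h k
  have hmain := blockDecaySum_ge_of_good_mass (t := t) hz1 hσ hε'0.le hGsub hfar hgood_mass
  have hzσ : 0 < z ^ (-σ) := Real.rpow_pos_of_pos hz0 _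
  -- `1 - cos ε' ≥ (2/π²) ε'²` and `ε'² = 1/(K₁² L²)`
  have hcos : 2 / Real.pi ^ 2 * ε' ^ 2 ≤ 1 - Real.cos ε' :=
    two_div_pi_sq_mul_sq_le_one_sub_cos (φ := ε') (by rw [abs_of_nonneg hε'0.le]; linarith)
  calc 17 / 100 * (2 / Real.pi ^ 2) / K₁ ^ 2 * (z ^ (1 - σ) / Real.log z ^ 3)
      = (2 / Real.pi ^ 2 * ε' ^ 2) * z ^ (-σ) / Real.log z * (17 / 100 * z) := by
        rw [show (1 : ℝ) - σ = -σ + 1 by ring, Real.rpow_add hz0, Real.rpow_one, hε', ← hL]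
        field_simp
    _ ≤ (1 - Real.cos ε') * z ^ (-σ) / Real.log z * (17 / 100 * z) := by
        have h0 : 0 ≤ z ^ (-σ) / Real.log z * (17 / 100 * z) := by rw [← hL]; positivity
        have := mul_le_mul_of_nonneg_right hcos h0
        simpa only [mul_div_assoc, mul_assoc] using this
    _ ≤ _ := hmain

end Literature.NumberTheory.Sieve

end
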